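import Summits.Ventures.PercRepro.RankLevelSetLevelSixHeavyCell
import Summits.Ventures.PercRepro.RankLevelSetDepCountHeavySq
import Summits.Ventures.PercRepro.RankLevelSetLevelSix
import Summits.Ventures.PercRepro.S1FourCircuitCount
import Summits.Ventures.PercRepro.RankLevelSetPlaneSix
import Summits.Ventures.PercRepro.S1TriangleCount
import Summits.Ventures.PercRepro.RankLevelSetTriangleStar
import Summits.Ventures.PercRepro.RankLevelSetCorankFiveCounts
import Summits.Ventures.PercRepro.RankLevelSetPlaneTen
import Summits.Ventures.PercRepro.RankLevelSetPlaneTenPrime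
import Summits.Ventures.PercRepro.S1TrianglePlusPlus
import Summits.Ventures.PercRepro.RankLevelSetCoreFour
import Summits.Ventures.PercRepro.RankLevelSetFrameLarge
import Summits.Ventures.PercRepro.RankLevelSetFrameQM
import Summits.Ventures.PercRepro.RankLevelSetLevelFiveAll
import Summits.Ventures.PercRepro.RankLevelSetLevelSixGiant
import Summits.Ventures.PercRepro.RankLevelSetCoreSixLowSelfDC

/-!
# PercRepro — THE REGIME-II CELLS `(31, 52 … 57)` AND THE CORANK-`≥ 52` CELLS OF RANK `31` (p8 g4, S3; part D)

`proofs/SUBCLAIM-S3-p8.md` §3q′. Part D of the corank regime (on parts A / B / C): at `p = 31` the subtracted-term key holds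
from `n₀ = 89` (`key_six_sub_31_89'`, decided; slack `1.35`; FALSE at `88`), so the cells `(31, d ≥ 58)` close by
LowSelf's device; the cells `(31, 52 … 57)` by REGIME II WITH THE HEAVY-FREE COUNT (`c025_core_six_cell_regII_top'`,
ratios `0.643 / 0.461 / 0.332 / 0.241 / 0.175 / 0.128`). Hence `c025_core_six_thirtyone_corank` (`p = 31`, `d ≥ 52`) and
**`c025_core_six_thirtynine_thirtyone' (31 ≤ p) (p + 51 < |E|)`** (`p ≥ 32` by part C). Axioms: standard.
-/

open scoped Matroid

namespace PercRepro

namespace ThmN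

open Set

variable {α : Type}

/-- The numeral of the cell `(31, 52)`: `2^{37}/C(37, 6)·U(83) + A(83) ≤ C(83, 30)`. -/
theorem cell_31_52_numeral' :
    ((2 : ℚ) ^ (31 + 6) / (((31 + 6).choose 6 : ℕ) : ℚ)) * ((((31 + 52).choose 6 : ℕ) : ℚ) +
      ((∑ i ∈ Finset.range (52 - 7 + 1), ((Nat.choose (min (min 19 (5 + 52) - 6) (34 - 2)) i : ℕ) : ℚ) / (((i : ℚ) + 1) ^ 2)) *
        ((((52 * 52 + 8 - 3 * 52) / 2 : ℕ) : ℚ) * ((31 + 52).choose 4 : ℚ) + ((52 * (52 + 1) * (52 + 2) / 3 : ℕ) : ℚ) * ((31 + 52).choose 3 : ℚ) +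
          (((52 + 4).choose 5 : ℕ) : ℚ) * ((31 + 52).choose 2 : ℚ) + (((52 + 5).choose 6 : ℕ) : ℚ) * ((31 + 52 : ℕ) : ℚ) +
          (((52 + 6).choose 7 : ℕ) : ℚ)) +
      (∑ i ∈ Finset.range (52 - 7 + 1), ((Nat.choose (34 - 2) i : ℕ) : ℚ) / (((i : ℚ) + 1) ^ 2)) *
        ((((52 * 52 + 8 - 3 * 52) / 2 : ℕ) : ℚ) * ((31 + 52).choose 4 : ℚ) + ((52 * (52 + 1) * (52 + 2) / 3 : ℕ) : ℚ) * ((31 + 52).choose 3 : ℚ) +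
          (((52 + 4).choose 5 : ℕ) : ℚ) * ((31 + 52).choose 2 : ℚ) + (((52 + 5).choose 6 : ℕ) : ℚ) * ((31 + 52 : ℕ) : ℚ) +
          (((52 + 6).choose 7 : ℕ) : ℚ)))) +
      (((∑ j ∈ Finset.range (6 + 1), (31 + 52).choose j) : ℕ) : ℚ) * 2 ^ 33 ≤ (((31 + 52).choose (31 - 1) : ℕ) : ℚ) := by
  have hσ1 : (∑ i ∈ Finset.range (52 - 7 + 1), ((Nat.choose (min (min 19 (5 + 52) - 6) (34 - 2)) i : ℕ) : ℚ) / (((i : ℚ) + 1) ^ 2)) =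
      (∑ i ∈ Finset.range (52 - 7 + 1), ((Nat.choose 13 i : ℕ) : ℚ) / (((i : ℚ) + 1) ^ 2)) := by
    norm_num
  have hσ2 : (∑ i ∈ Finset.range (52 - 7 + 1), ((Nat.choose (34 - 2) i : ℕ) : ℚ) / (((i : ℚ) + 1) ^ 2)) =
      (∑ i ∈ Finset.range (52 - 7 + 1), ((Nat.choose 32 i : ℕ) : ℚ) / (((i : ℚ) + 1) ^ 2)) := by
    norm_num
  rw [hσ1, hσ2]
  simp only [Finset.sum_range_succ, Finset.sum_range_zero]
  norm_num [Nat.choose]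

/-- **The cell `(31, 52)`.** -/
theorem c025_core_six_cell_31_52' (M : Matroid α) [M.Finite] (hR : M.eRank = (31 : ℕ∞)) (hn : M.E.ncard = 31 + 52)
    (hfree : ∀ e ∈ M.E, ∃ A ⊆ M.E \ {e}, e ∉ M.closure A ∧ e ∉ M.closure ((M.E \ {e}) \ A)) : RLS M 31 6 :=
  c025_core_six_cell_regII_top' M 31 52 (by norm_num) (by norm_num) hR hn hfree cell_31_52_numeral'

/-- The numeral of the cell `(31, 53)`: `2^{37}/C(37, 6)·U(84) + A(84) ≤ C(84, 30)`. -/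
theorem cell_31_53_numeral' :
    ((2 : ℚ) ^ (31 + 6) / (((31 + 6).choose 6 : ℕ) : ℚ)) * ((((31 + 53).choose 6 : ℕ) : ℚ) +
      ((∑ i ∈ Finset.range (53 - 7 + 1), ((Nat.choose (min (min 19 (5 + 53) - 6) (34 - 2)) i : ℕ) : ℚ) / (((i : ℚ) + 1) ^ 2)) *
        ((((53 * 53 + 8 - 3 * 53) / 2 : ℕ) : ℚ) * ((31 + 53).choose 4 : ℚ) + ((53 * (53 + 1) * (53 + 2) / 3 : ℕ) : ℚ) * ((31 + 53).choose 3 : ℚ) +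
          (((53 + 4).choose 5 : ℕ) : ℚ) * ((31 + 53).choose 2 : ℚ) + (((53 + 5).choose 6 : ℕ) : ℚ) * ((31 + 53 : ℕ) : ℚ) +
          (((53 + 6).choose 7 : ℕ) : ℚ)) +
      (∑ i ∈ Finset.range (53 - 7 + 1), ((Nat.choose (34 - 2) i : ℕ) : ℚ) / (((i : ℚ) + 1) ^ 2)) *
        ((((53 * 53 + 8 - 3 * 53) / 2 : ℕ) : ℚ) * ((31 + 53).choose 4 : ℚ) + ((53 * (53 + 1) * (53 + 2) / 3 : ℕ) : ℚ) * ((31 + 53).choose 3 : ℚ) +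
          (((53 + 4).choose 5 : ℕ) : ℚ) * ((31 + 53).choose 2 : ℚ) + (((53 + 5).choose 6 : ℕ) : ℚ) * ((31 + 53 : ℕ) : ℚ) +
          (((53 + 6).choose 7 : ℕ) : ℚ)))) +
      (((∑ j ∈ Finset.range (6 + 1), (31 + 53).choose j) : ℕ) : ℚ) * 2 ^ 33 ≤ (((31 + 53).choose (31 - 1) : ℕ) : ℚ) := by
  have hσ1 : (∑ i ∈ Finset.range (53 - 7 + 1), ((Nat.choose (min (min 19 (5 + 53) - 6) (34 - 2)) i : ℕ) : ℚ) / (((i : ℚ) + 1) ^ 2)) =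
      (∑ i ∈ Finset.range (53 - 7 + 1), ((Nat.choose 13 i : ℕ) : ℚ) / (((i : ℚ) + 1) ^ 2)) := by
    norm_num
  have hσ2 : (∑ i ∈ Finset.range (53 - 7 + 1), ((Nat.choose (34 - 2) i : ℕ) : ℚ) / (((i : ℚ) + 1) ^ 2)) =
      (∑ i ∈ Finset.range (53 - 7 + 1), ((Nat.choose 32 i : ℕ) : ℚ) / (((i : ℚ) + 1) ^ 2)) := by
    norm_num
  rw [hσ1, hσ2]
  simp only [Finset.sum_range_succ, Finset.sum_range_zero]
  norm_num [Nat.choose]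

/-- **The cell `(31, 53)`.** -/
theorem c025_core_six_cell_31_53' (M : Matroid α) [M.Finite] (hR : M.eRank = (31 : ℕ∞)) (hn : M.E.ncard = 31 + 53)
    (hfree : ∀ e ∈ M.E, ∃ A ⊆ M.E \ {e}, e ∉ M.closure A ∧ e ∉ M.closure ((M.E \ {e}) \ A)) : RLS M 31 6 :=
  c025_core_six_cell_regII_top' M 31 53 (by norm_num) (by norm_num) hR hn hfree cell_31_53_numeral'

/-- The numeral of the cell `(31, 54)`: `2^{37}/C(37, 6)·U(85) + A(85) ≤ C(85, 30)`. -/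
theorem cell_31_54_numeral' :
    ((2 : ℚ) ^ (31 + 6) / (((31 + 6).choose 6 : ℕ) : ℚ)) * ((((31 + 54).choose 6 : ℕ) : ℚ) +
      ((∑ i ∈ Finset.range (54 - 7 + 1), ((Nat.choose (min (min 19 (5 + 54) - 6) (34 - 2)) i : ℕ) : ℚ) / (((i : ℚ) + 1) ^ 2)) *
        ((((54 * 54 + 8 - 3 * 54) / 2 : ℕ) : ℚ) * ((31 + 54).choose 4 : ℚ) + ((54 * (54 + 1) * (54 + 2) / 3 : ℕ) : ℚ) * ((31 + 54).choose 3 : ℚ) +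
          (((54 + 4).choose 5 : ℕ) : ℚ) * ((31 + 54).choose 2 : ℚ) + (((54 + 5).choose 6 : ℕ) : ℚ) * ((31 + 54 : ℕ) : ℚ) +
          (((54 + 6).choose 7 : ℕ) : ℚ)) +
      (∑ i ∈ Finset.range (54 - 7 + 1), ((Nat.choose (34 - 2) i : ℕ) : ℚ) / (((i : ℚ) + 1) ^ 2)) *
        ((((54 * 54 + 8 - 3 * 54) / 2 : ℕ) : ℚ) * ((31 + 54).choose 4 : ℚ) + ((54 * (54 + 1) * (54 + 2) / 3 : ℕ) : ℚ) * ((31 + 54).choose 3 : ℚ) +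
          (((54 + 4).choose 5 : ℕ) : ℚ) * ((31 + 54).choose 2 : ℚ) + (((54 + 5).choose 6 : ℕ) : ℚ) * ((31 + 54 : ℕ) : ℚ) +
          (((54 + 6).choose 7 : ℕ) : ℚ)))) +
      (((∑ j ∈ Finset.range (6 + 1), (31 + 54).choose j) : ℕ) : ℚ) * 2 ^ 33 ≤ (((31 + 54).choose (31 - 1) : ℕ) : ℚ) := by
  have hσ1 : (∑ i ∈ Finset.range (54 - 7 + 1), ((Nat.choose (min (min 19 (5 + 54) - 6) (34 - 2)) i : ℕ) : ℚ) / (((i : ℚ) + 1) ^ 2)) =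
      (∑ i ∈ Finset.range (54 - 7 + 1), ((Nat.choose 13 i : ℕ) : ℚ) / (((i : ℚ) + 1) ^ 2)) := by
    norm_num
  have hσ2 : (∑ i ∈ Finset.range (54 - 7 + 1), ((Nat.choose (34 - 2) i : ℕ) : ℚ) / (((i : ℚ) + 1) ^ 2)) =
      (∑ i ∈ Finset.range (54 - 7 + 1), ((Nat.choose 32 i : ℕ) : ℚ) / (((i : ℚ) + 1) ^ 2)) := by
    norm_num
  rw [hσ1, hσ2]
  simp only [Finset.sum_range_succ, Finset.sum_range_zero]
  norm_num [Nat.choose]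

/-- **The cell `(31, 54)`.** -/
theorem c025_core_six_cell_31_54' (M : Matroid α) [M.Finite] (hR : M.eRank = (31 : ℕ∞)) (hn : M.E.ncard = 31 + 54)
    (hfree : ∀ e ∈ M.E, ∃ A ⊆ M.E \ {e}, e ∉ M.closure A ∧ e ∉ M.closure ((M.E \ {e}) \ A)) : RLS M 31 6 :=
  c025_core_six_cell_regII_top' M 31 54 (by norm_num) (by norm_num) hR hn hfree cell_31_54_numeral'

/-- The numeral of the cell `(31, 55)`: `2^{37}/C(37, 6)·U(86) + A(86) ≤ C(86, 30)`. -/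
theorem cell_31_55_numeral' :
    ((2 : ℚ) ^ (31 + 6) / (((31 + 6).choose 6 : ℕ) : ℚ)) * ((((31 + 55).choose 6 : ℕ) : ℚ) +
      ((∑ i ∈ Finset.range (55 - 7 + 1), ((Nat.choose (min (min 19 (5 + 55) - 6) (34 - 2)) i : ℕ) : ℚ) / (((i : ℚ) + 1) ^ 2)) *
        ((((55 * 55 + 8 - 3 * 55) / 2 : ℕ) : ℚ) * ((31 + 55).choose 4 : ℚ) + ((55 * (55 + 1) * (55 + 2) / 3 : ℕ) : ℚ) * ((31 + 55).choose 3 : ℚ) +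
          (((55 + 4).choose 5 : ℕ) : ℚ) * ((31 + 55).choose 2 : ℚ) + (((55 + 5).choose 6 : ℕ) : ℚ) * ((31 + 55 : ℕ) : ℚ) +
          (((55 + 6).choose 7 : ℕ) : ℚ)) +
      (∑ i ∈ Finset.range (55 - 7 + 1), ((Nat.choose (34 - 2) i : ℕ) : ℚ) / (((i : ℚ) + 1) ^ 2)) *
        ((((55 * 55 + 8 - 3 * 55) / 2 : ℕ) : ℚ) * ((31 + 55).choose 4 : ℚ) + ((55 * (55 + 1) * (55 + 2) / 3 : ℕ) : ℚ) * ((31 + 55).choose 3 : ℚ) +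
          (((55 + 4).choose 5 : ℕ) : ℚ) * ((31 + 55).choose 2 : ℚ) + (((55 + 5).choose 6 : ℕ) : ℚ) * ((31 + 55 : ℕ) : ℚ) +
          (((55 + 6).choose 7 : ℕ) : ℚ)))) +
      (((∑ j ∈ Finset.range (6 + 1), (31 + 55).choose j) : ℕ) : ℚ) * 2 ^ 33 ≤ (((31 + 55).choose (31 - 1) : ℕ) : ℚ) := by
  have hσ1 : (∑ i ∈ Finset.range (55 - 7 + 1), ((Nat.choose (min (min 19 (5 + 55) - 6) (34 - 2)) i : ℕ) : ℚ) / (((i : ℚ) + 1) ^ 2)) =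
      (∑ i ∈ Finset.range (55 - 7 + 1), ((Nat.choose 13 i : ℕ) : ℚ) / (((i : ℚ) + 1) ^ 2)) := by
    norm_num
  have hσ2 : (∑ i ∈ Finset.range (55 - 7 + 1), ((Nat.choose (34 - 2) i : ℕ) : ℚ) / (((i : ℚ) + 1) ^ 2)) =
      (∑ i ∈ Finset.range (55 - 7 + 1), ((Nat.choose 32 i : ℕ) : ℚ) / (((i : ℚ) + 1) ^ 2)) := by
    norm_num
  rw [hσ1, hσ2]
  simp only [Finset.sum_range_succ, Finset.sum_range_zero]
  norm_num [Nat.choose]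

/-- **The cell `(31, 55)`.** -/
theorem c025_core_six_cell_31_55' (M : Matroid α) [M.Finite] (hR : M.eRank = (31 : ℕ∞)) (hn : M.E.ncard = 31 + 55)
    (hfree : ∀ e ∈ M.E, ∃ A ⊆ M.E \ {e}, e ∉ M.closure A ∧ e ∉ M.closure ((M.E \ {e}) \ A)) : RLS M 31 6 :=
  c025_core_six_cell_regII_top' M 31 55 (by norm_num) (by norm_num) hR hn hfree cell_31_55_numeral'

/-- The numeral of the cell `(31, 56)`: `2^{37}/C(37, 6)·U(87) + A(87) ≤ C(87, 30)`. -/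
theorem cell_31_56_numeral' :
    ((2 : ℚ) ^ (31 + 6) / (((31 + 6).choose 6 : ℕ) : ℚ)) * ((((31 + 56).choose 6 : ℕ) : ℚ) +
      ((∑ i ∈ Finset.range (56 - 7 + 1), ((Nat.choose (min (min 19 (5 + 56) - 6) (34 - 2)) i : ℕ) : ℚ) / (((i : ℚ) + 1) ^ 2)) *
        ((((56 * 56 + 8 - 3 * 56) / 2 : ℕ) : ℚ) * ((31 + 56).choose 4 : ℚ) + ((56 * (56 + 1) * (56 + 2) / 3 : ℕ) : ℚ) * ((31 + 56).choose 3 : ℚ) +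
          (((56 + 4).choose 5 : ℕ) : ℚ) * ((31 + 56).choose 2 : ℚ) + (((56 + 5).choose 6 : ℕ) : ℚ) * ((31 + 56 : ℕ) : ℚ) +
          (((56 + 6).choose 7 : ℕ) : ℚ)) +
      (∑ i ∈ Finset.range (56 - 7 + 1), ((Nat.choose (34 - 2) i : ℕ) : ℚ) / (((i : ℚ) + 1) ^ 2)) *
        ((((56 * 56 + 8 - 3 * 56) / 2 : ℕ) : ℚ) * ((31 + 56).choose 4 : ℚ) + ((56 * (56 + 1) * (56 + 2) / 3 : ℕ) : ℚ) * ((31 + 56).choose 3 : ℚ) +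
          (((56 + 4).choose 5 : ℕ) : ℚ) * ((31 + 56).choose 2 : ℚ) + (((56 + 5).choose 6 : ℕ) : ℚ) * ((31 + 56 : ℕ) : ℚ) +
          (((56 + 6).choose 7 : ℕ) : ℚ)))) +
      (((∑ j ∈ Finset.range (6 + 1), (31 + 56).choose j) : ℕ) : ℚ) * 2 ^ 33 ≤ (((31 + 56).choose (31 - 1) : ℕ) : ℚ) := by
  have hσ1 : (∑ i ∈ Finset.range (56 - 7 + 1), ((Nat.choose (min (min 19 (5 + 56) - 6) (34 - 2)) i : ℕ) : ℚ) / (((i : ℚ) + 1) ^ 2)) =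
      (∑ i ∈ Finset.range (56 - 7 + 1), ((Nat.choose 13 i : ℕ) : ℚ) / (((i : ℚ) + 1) ^ 2)) := by
    norm_num
  have hσ2 : (∑ i ∈ Finset.range (56 - 7 + 1), ((Nat.choose (34 - 2) i : ℕ) : ℚ) / (((i : ℚ) + 1) ^ 2)) =
      (∑ i ∈ Finset.range (56 - 7 + 1), ((Nat.choose 32 i : ℕ) : ℚ) / (((i : ℚ) + 1) ^ 2)) := by
    norm_num
  rw [hσ1, hσ2]
  simp only [Finset.sum_range_succ, Finset.sum_range_zero]
  norm_num [Nat.choose]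

/-- **The cell `(31, 56)`.** -/
theorem c025_core_six_cell_31_56' (M : Matroid α) [M.Finite] (hR : M.eRank = (31 : ℕ∞)) (hn : M.E.ncard = 31 + 56)
    (hfree : ∀ e ∈ M.E, ∃ A ⊆ M.E \ {e}, e ∉ M.closure A ∧ e ∉ M.closure ((M.E \ {e}) \ A)) : RLS M 31 6 :=
  c025_core_six_cell_regII_top' M 31 56 (by norm_num) (by norm_num) hR hn hfree cell_31_56_numeral'

/-- The numeral of the cell `(31, 57)`: `2^{37}/C(37, 6)·U(88) + A(88) ≤ C(88, 30)`. -/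
theorem cell_31_57_numeral' :
    ((2 : ℚ) ^ (31 + 6) / (((31 + 6).choose 6 : ℕ) : ℚ)) * ((((31 + 57).choose 6 : ℕ) : ℚ) +
      ((∑ i ∈ Finset.range (57 - 7 + 1), ((Nat.choose (min (min 19 (5 + 57) - 6) (34 - 2)) i : ℕ) : ℚ) / (((i : ℚ) + 1) ^ 2)) *
        ((((57 * 57 + 8 - 3 * 57) / 2 : ℕ) : ℚ) * ((31 + 57).choose 4 : ℚ) + ((57 * (57 + 1) * (57 + 2) / 3 : ℕ) : ℚ) * ((31 + 57).choose 3 : ℚ) +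
          (((57 + 4).choose 5 : ℕ) : ℚ) * ((31 + 57).choose 2 : ℚ) + (((57 + 5).choose 6 : ℕ) : ℚ) * ((31 + 57 : ℕ) : ℚ) +
          (((57 + 6).choose 7 : ℕ) : ℚ)) +
      (∑ i ∈ Finset.range (57 - 7 + 1), ((Nat.choose (34 - 2) i : ℕ) : ℚ) / (((i : ℚ) + 1) ^ 2)) *
        ((((57 * 57 + 8 - 3 * 57) / 2 : ℕ) : ℚ) * ((31 + 57).choose 4 : ℚ) + ((57 * (57 + 1) * (57 + 2) / 3 : ℕ) : ℚ) * ((31 + 57).choose 3 : ℚ) +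
          (((57 + 4).choose 5 : ℕ) : ℚ) * ((31 + 57).choose 2 : ℚ) + (((57 + 5).choose 6 : ℕ) : ℚ) * ((31 + 57 : ℕ) : ℚ) +
          (((57 + 6).choose 7 : ℕ) : ℚ)))) +
      (((∑ j ∈ Finset.range (6 + 1), (31 + 57).choose j) : ℕ) : ℚ) * 2 ^ 33 ≤ (((31 + 57).choose (31 - 1) : ℕ) : ℚ) := by
  have hσ1 : (∑ i ∈ Finset.range (57 - 7 + 1), ((Nat.choose (min (min 19 (5 + 57) - 6) (34 - 2)) i : ℕ) : ℚ) / (((i : ℚ) + 1) ^ 2)) =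
      (∑ i ∈ Finset.range (57 - 7 + 1), ((Nat.choose 13 i : ℕ) : ℚ) / (((i : ℚ) + 1) ^ 2)) := by
    norm_num
  have hσ2 : (∑ i ∈ Finset.range (57 - 7 + 1), ((Nat.choose (34 - 2) i : ℕ) : ℚ) / (((i : ℚ) + 1) ^ 2)) =
      (∑ i ∈ Finset.range (57 - 7 + 1), ((Nat.choose 32 i : ℕ) : ℚ) / (((i : ℚ) + 1) ^ 2)) := by
    norm_num
  rw [hσ1, hσ2]
  simp only [Finset.sum_range_succ, Finset.sum_range_zero]
  norm_num [Nat.choose]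

/-- **The cell `(31, 57)`.** -/
theorem c025_core_six_cell_31_57' (M : Matroid α) [M.Finite] (hR : M.eRank = (31 : ℕ∞)) (hn : M.E.ncard = 31 + 57)
    (hfree : ∀ e ∈ M.E, ∃ A ⊆ M.E \ {e}, e ∉ M.closure A ∧ e ∉ M.closure ((M.E \ {e}) \ A)) : RLS M 31 6 :=
  c025_core_six_cell_regII_top' M 31 57 (by norm_num) (by norm_num) hR hn hfree cell_31_57_numeral'

/-- The key with the subtracted term at `p = 31`, `n = 89` — one numeral, decided. -/
theorem key_six_sub_31_89' :
    (2 ^ 37 + 7700 * Nat.choose 37 31) * 2 ^ 33 * Nat.choose 89 6 ≤ Nat.choose 37 31 * Nat.choose 89 30 := by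
  decide

/-- **The `e`-free core at level `6`, rank `31`, every corank `≥ 52`** (the six regime-II cells up to `n = 88`, the key at
`n₀ = 89`). -/
theorem c025_core_six_thirtyone_corank (M : Matroid α) [M.Finite]
    (hR : M.eRank = (31 : ℕ∞)) (hbig : 31 + 51 < M.E.ncard)
    (hfree : ∀ e ∈ M.E, ∃ A ⊆ M.E \ {e}, e ∉ M.closure A ∧ e ∉ M.closure ((M.E \ {e}) \ A)) : RLS M 31 6 := by
  rcases Nat.lt_or_ge M.E.ncard 89 with hsmall | hbig89
  · rcases Nat.lt_or_ge M.E.ncard 84 with h | h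
    · exact c025_core_six_cell_31_52' M hR (by omega) hfree
    rcases Nat.lt_or_ge M.E.ncard 85 with h' | h'
    · exact c025_core_six_cell_31_53' M hR (by omega) hfree
    rcases Nat.lt_or_ge M.E.ncard 86 with h'' | h''
    · exact c025_core_six_cell_31_54' M hR (by omega) hfree
    rcases Nat.lt_or_ge M.E.ncard 87 with h3 | h3
    · exact c025_core_six_cell_31_55' M hR (by omega) hfree
    rcases Nat.lt_or_ge M.E.ncard 88 with h4 | h4
    · exact c025_core_six_cell_31_56' M hR (by omega) hfree
    · exact c025_core_six_cell_31_57' M hR (by omega) hfree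
  · refine core_six_corank_of_key_sub' 89 le_rfl M 31 (by norm_num) ?_ (by omega) hfree
    have hk := key_of_base' 31 6 ((2 ^ 37 + 7700 * Nat.choose 37 31) * 2 ^ 33) (Nat.choose 37 31) 89
      (by norm_num) (by norm_num) (by norm_num) key_six_sub_31_89'
    intro n hn
    have := hk n hn
    simpa using this

/-- **The `e`-free core at level `6`, every corank `≥ 52`, every rank `p ≥ 31`** (`p ≥ 32`: part C; `p = 31`: above). -/
theorem c025_core_six_thirtynine_thirtyone' (M : Matroid α) [M.Finite] (p : ℕ) (hp : 31 ≤ p)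
    (hR : M.eRank = (p : ℕ∞)) (hbig : p + 51 < M.E.ncard)
    (hfree : ∀ e ∈ M.E, ∃ A ⊆ M.E \ {e}, e ∉ M.closure A ∧ e ∉ M.closure ((M.E \ {e}) \ A)) : RLS M p 6 := by
  rcases Nat.lt_or_ge p 32 with hlt | hge
  · have hp31 : p = 31 := by omega
    subst hp31
    exact c025_core_six_thirtyone_corank M hR hbig hfree
  · exact c025_core_six_thirtynine_thirtytwo' M p hge hR hbig hfree

end ThmN

end PercRepro
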